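import Literature.IUT.HodgeTheaters.PiAvatarLocalLabels
import Literature.IUT.HodgeTheaters.PiAvatarGlobTransport
import HarnessLib

/-!
# KIT-INSTANCE-SPEC P5-binding, LOCAL slots (III): the place-agnostic LOCAL DATUM `{Π_v̲ ≤ Π^±_v̲ ≤ Π_{X̲_K}}`, the ambient
# `Amb v` := the objects IN PLAY (isomorphs of `𝒟_v̲`, of `†𝒟_v̲^±`, of `𝒟^{⊚±}`), and the kit slot `labMap` on ALL of it with its
# laws ([IUTchI] Def 4.1 (i), Def 6.1 (ii)(iii)(vii); defs — post-freeze additive D13, not a cone member)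

S. Mochizuki, *Inter-universal Teichmüller theory I*, kurims manuscript (May 2020), Def 6.1 (iii) p. 156–157 («`LabCusp^±(†𝒟_v)` … may be
constructed solely from `†𝒟_v`»; «natural surjection `Aut(†𝒟_v) ↠ {±1}` … by considering the induced automorphism of `LabCusp^±(†𝒟_v)`»),
Def 6.1 (ii) p. 156 (`†𝒟_v → †𝒟_v^±`, `†𝒟_v^±` «corresponding to `X̲_v`» — underlined), Def 4.1 (i) p. 95 («`†𝒟_v` … a category
equivalent to `𝒟_v`»), Def 6.1 (vii) p. 159 (morphisms `†𝒟_v → †𝒟^{⊚±}` live in one ambient) ([IUTchI] Def 6.1 (iii) p.156)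
[claim: Mochizuki2012, status: disputed] (D-0012 claim key, series status DISPUTED — definitions and kernel theorems over abc-iut-L5-t2's
REAL `InitialThetaData`, abc-iut-L5-t1's `CuspGalois`, under the binders `hS` (G-L5t4g3-3) and the local arrow law `LocalArrowLaw`
(p440701); nothing of the series is asserted, no side is taken on [IUTchIII] Cor. 3.12).

## Design (HOME/staging/L5/L5-t4/g4/DESIGN-LocalSlots.md; D1 EMBEDDED)
* `cuspTransport q` — the label bijection attached to a coset `q = m·Π_{X̲_K}` of an element `m ∈ N(Π_{X̲_K})`: `(actF m)⁻¹` (junk `1` off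
  `N(Π_{X̲_K})`); `subLabAut R` — the label action `Aut(ℬ(R)⁰) → Perm Cusp(X̲_K)` for ANY `R ≤ Π_{X̲_K}` with `N(R) ≤ N(Π_{X̲_K})` (for
  `R = Π_v̲` this is `locLabAut`, for `R = Π_{X̲_K}` it is `gLabAutModel`).
* `LocalDatum` — the data of ONE place in the Π-avatar: `H = Π_v̲ ≤ Hund = Π^±_v̲ ≤ Π_{X̲_K}` with the local arrow law of `H`, the
  normaliser step `N(H) ≤ N(Hund)` (Cor 1.2 embedded) and the existence of a negative element (the `±`-involution). GOOD places:
  `H = Π_{X̲→_K} ∩ augGF⁻¹ G_v̲`, `Hund = Π_{X̲_K} ∩ augGF⁻¹ G_v̲` (`PiAvatarLocalOvergroupUnd`); BAD places: the SHAPE-OF-RECORD pair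
  (G-L5t4g3-2 (iii)); the kit assembly is then place-agnostic.
* `LocalDatum.InPlay` / `Amb` — the kit's `Amb v`: the FULL SUBCATEGORY of the Π-ambient on the isomorphs of `𝒟_v̲ = ℬ(H)⁰`, of
  `†𝒟_v̲^± = ℬ(Hund)⁰` and of `𝒟^{⊚±}` (the objects Def 6.1 puts in play at `v̲`; no junk objects, so the kit laws are theorems);
  `model`, `undModel`, `atV : Glob ⥤ Amb` (inclusion), `phiEll` (`xΠ_v̲ ↦ xΠ_{X̲_K}`, Ex 6.3 (i)).
* kit slot **`labMapAmb φ`** for an iso `φ : X ≅ Y` of ambient objects in play: the label action of the marking-reduced automorphism of the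
  relevant model (`locLabAut` / `subLabAut Hund` / `gLabAutModel`); laws `labMapAmb_refl`, `labMapAmb_trans` (functoriality),
  `labMapAmb_trans_mem_charts` (kit law `labMap_charts`), `exists_labMapAmb_ne_refl` (kit law `exists_negative`).
No instance, no notation; typed ≠ proved elsewhere; binder ≠ fact.
-/

noncomputable section

namespace Literature.IUT.HodgeTheaters

open CategoryTheory

universe u v w

section LocalAmbient

variable {F : Type u} {K : Type v} {Fbar : Type w} [Field F] [NumberField F] [Field K] [NumberField K]
  [Algebra F K] [Field Fbar] [Algebra F Fbar] [Algebra K Fbar]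
  {E : WeierstrassCurve F} [E.IsElliptic] {l : ℕ} {Pb : BadPlacePredicates K}
  (D : InitialThetaData F K Fbar E l Pb) (CG : D.geom.pe.CuspGalois) (hS : D.CuspClassesNormaliserStable)

namespace InitialThetaData

/-! ### Cusp transport along cosets of `N(Π_{X̲_K})` -/

open Classical in
/-- **The label bijection attached to a coset `q ∈ Π_{C_F}/Π_{X̲_K}`**: `(actF m)⁻¹` if `q = mΠ_{X̲_K}` with `m ∈ N(Π_{X̲_K})` (well defined:
`Π_{X̲_K}` acts trivially), the identity otherwise (never used). This is the map on `±`-label classes of the morphism `ℬ(R)⁰ → 𝒟^{⊚±}`,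
`xR ↦ xmΠ_{X̲_K}` ([IUTchI] Prop 6.5 (i): morphisms of bridges induce maps of label classes). ([IUTchI] Def 6.1 (vi) p.159) [claim: Mochizuki2012, status: disputed] -/
def cuspTransport (q : D.PiC ⧸ D.PiXund) : Equiv.Perm D.geom.pe.Cusp :=
  if h : ∃ m : ↥(Subgroup.normalizer ((D.PiXund : Subgroup D.PiC) : Set D.PiC)),
      (QuotientGroup.mk (m : D.PiC) : D.PiC ⧸ D.PiXund) = q
  then (D.actF CG hS h.choose)⁻¹ else 1

/-- `cuspTransport (mΠ_{X̲_K}) = (actF m)⁻¹` for `m ∈ N(Π_{X̲_K})`. ([IUTchI] Def 6.1 (vi) p.159) [claim: Mochizuki2012, status: disputed] -/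
theorem cuspTransport_mk (m : ↥(Subgroup.normalizer ((D.PiXund : Subgroup D.PiC) : Set D.PiC))) :
    D.cuspTransport CG hS (QuotientGroup.mk (m : D.PiC)) = (D.actF CG hS m)⁻¹ := by
  have h : ∃ m' : ↥(Subgroup.normalizer ((D.PiXund : Subgroup D.PiC) : Set D.PiC)),
      (QuotientGroup.mk (m' : D.PiC) : D.PiC ⧸ D.PiXund) = QuotientGroup.mk (m : D.PiC) := ⟨m, rfl⟩
  rw [cuspTransport, dif_pos h, D.actF_eq_of_inv_mul_mem CG hS h.choose m (QuotientGroup.eq.mp h.choose_spec)]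

/-- Right equivariance: `cuspTransport (m·n·Π) = (actF n)⁻¹ ∘ cuspTransport (mΠ)` (as permutations: `· * ·`).
([IUTchI] Def 6.1 (vi) p.159) [claim: Mochizuki2012, status: disputed] -/
theorem cuspTransport_mk_mul (m n : ↥(Subgroup.normalizer ((D.PiXund : Subgroup D.PiC) : Set D.PiC))) :
    D.cuspTransport CG hS (QuotientGroup.mk ((m : D.PiC) * n)) = (D.actF CG hS n)⁻¹ * D.cuspTransport CG hS (QuotientGroup.mk (m : D.PiC)) := by
  rw [← Subgroup.coe_mul, cuspTransport_mk, cuspTransport_mk, map_mul, mul_inv_rev]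

/-! ### The label action of `Aut(ℬ(R)⁰)` for a subgroup `R ≤ Π_{X̲_K}` with `N(R) ≤ N(Π_{X̲_K})` -/

section SubLabAut

variable {R : Subgroup D.PiC}
  (hN : Subgroup.normalizer ((R : Subgroup D.PiC) : Set D.PiC) ≤ Subgroup.normalizer ((D.PiXund : Subgroup D.PiC) : Set D.PiC))
  (hle : R ≤ D.PiXund)

/-- `actF` restricted along `N(R) ≤ N(Π_{X̲_K})`. ([IUTchI] Def 6.1 (iii) p.157) [claim: Mochizuki2012, status: disputed] -/
def subActF : ↥(Subgroup.normalizer ((R : Subgroup D.PiC) : Set D.PiC)) →* Equiv.Perm D.geom.pe.Cusp :=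
  (D.actF CG hS).comp (Subgroup.inclusion hN)

include hle in
/-- `R` acts trivially. ([IUTchI] Def 6.1 (iii) p.157) [claim: Mochizuki2012, status: disputed] -/
theorem subgroupOf_le_ker_subActF :
    R.subgroupOf (Subgroup.normalizer ((R : Subgroup D.PiC) : Set D.PiC)) ≤ (D.subActF CG hS hN).ker := by
  intro n hn
  rw [MonoidHom.mem_ker]
  exact D.actF_eq_one_of_mem_PiXund CG hS _ (hle (Subgroup.mem_subgroupOf.mp hn))

/-- **The label action `Aut(ℬ(R)⁰) → Perm Cusp(X̲_K)`** of the automorphisms of an embedded object `ℬ(R)⁰`, `R ≤ Π_{X̲_K}`, all of whose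
automorphisms are induced from `𝒟^{⊚±}` (`N(R) ≤ N(Π_{X̲_K})`): `autEquiv⁻¹` then `actF` descended modulo `R`.
([IUTchI] Def 6.1 (iii) p.157) [claim: Mochizuki2012, status: disputed] -/
def subLabAut : Aut (OrbitCat.of R) →* Equiv.Perm D.geom.pe.Cusp :=
  (QuotientGroup.lift _ (D.subActF CG hS hN) (D.subgroupOf_le_ker_subActF CG hS hN hle)).comp
    (OrbitCat.autEquiv R).symm.toMonoidHom

/-- Convention: on `xR ↦ xmR` the action is `(actF m)⁻¹`. ([IUTchI] Def 6.1 (iii) p.157) [claim: Mochizuki2012, status: disputed] -/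
theorem subLabAut_autOfNormalizer (m : D.PiC) (hm : m ∈ Subgroup.normalizer ((R : Subgroup D.PiC) : Set D.PiC)) :
    D.subLabAut CG hS hN hle (OrbitCat.autOfNormalizer m hm) = (D.actF CG hS ⟨m, hN hm⟩)⁻¹ := by
  have h1 : (OrbitCat.autOfNormalizer m hm : Aut (OrbitCat.of R)) =
      OrbitCat.autEquiv R (QuotientGroup.mk ⟨m⁻¹, Subgroup.inv_mem _ hm⟩) := by
    rw [OrbitCat.autEquiv_mk, OrbitCat.autOfNormalizerHom_apply, OrbitCat.autOfNormalizer_eq_iff]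
    simp
  have h2 : (OrbitCat.autEquiv R).symm (OrbitCat.autOfNormalizer m hm) = QuotientGroup.mk ⟨m⁻¹, Subgroup.inv_mem _ hm⟩ := by
    rw [h1, MulEquiv.symm_apply_apply]
  have h3 : (⟨m⁻¹, Subgroup.inv_mem _ hm⟩ : ↥(Subgroup.normalizer ((R : Subgroup D.PiC) : Set D.PiC))) = ⟨m, hm⟩⁻¹ := rfl
  change QuotientGroup.lift _ (D.subActF CG hS hN) (D.subgroupOf_le_ker_subActF CG hS hN hle)
      ((OrbitCat.autEquiv R).symm (OrbitCat.autOfNormalizer m hm)) = _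
  rw [h2, QuotientGroup.lift_mk, h3, map_inv]
  rfl

/-- `subLabAut (xR ↦ xmR) = cuspTransport (mΠ_{X̲_K})`. ([IUTchI] Def 6.1 (iii) p.157) [claim: Mochizuki2012, status: disputed] -/
theorem subLabAut_autOfNormalizer_eq_cuspTransport (m : D.PiC)
    (hm : m ∈ Subgroup.normalizer ((R : Subgroup D.PiC) : Set D.PiC)) :
    D.subLabAut CG hS hN hle (OrbitCat.autOfNormalizer m hm) = D.cuspTransport CG hS (QuotientGroup.mk m) := by
  rw [subLabAut_autOfNormalizer]
  exact (D.cuspTransport_mk CG hS ⟨m, hN hm⟩).symm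

end SubLabAut

/-- At `R = Π_v̲` with its local arrow law, `subLabAut` IS `locLabAut`. ([IUTchI] Def 6.1 (iii) p.157) [claim: Mochizuki2012, status: disputed] -/
theorem LocalArrowLaw.locLabAut_eq_subLabAut [Fact l.Prime] {H : Subgroup D.PiC} (Λ : D.LocalArrowLaw CG hS H) :
    Λ.locLabAut = D.subLabAut CG hS Λ.normalizer_le Λ.le_PiXund := by
  ext α : 1
  obtain ⟨m, hm, rfl⟩ := OrbitCat.exists_eq_autOfNormalizer α
  rw [Λ.locLabAut_autOfNormalizer, D.subLabAut_autOfNormalizer CG hS]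

/-- At `R = Π_{X̲_K}`, `subLabAut` IS `gLabAutModel`. ([IUTchI] Def 6.1 (v) p.158) [claim: Mochizuki2012, status: disputed] -/
theorem gLabAutModel_eq_subLabAut :
    D.gLabAutModel CG hS = D.subLabAut CG hS (R := D.PiXund) le_rfl le_rfl := by
  ext α : 1
  obtain ⟨m, hm, rfl⟩ := OrbitCat.exists_eq_autOfNormalizer α
  rw [D.gLabAutModel_autOfNormalizer CG hS, D.subLabAut_autOfNormalizer CG hS]

/-! ### Ambient markings of isomorphs of `𝒟^{⊚±}` -/

open Classical in
/-- A chosen isomorphism `X ⥲ 𝒟^{⊚±}` of an AMBIENT isomorph of `𝒟^{⊚±}` (the identity at `𝒟^{⊚±}` itself).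
([IUTchI] Def 6.1 (vi) p.159) [claim: Mochizuki2012, status: disputed] -/
def glbMark (X : D.PiAmbient) (hX : Nonempty (X ≅ D.gModelObj)) : X ≅ D.gModelObj :=
  if h : X = D.gModelObj then eqToIso h else hX.some

/-- The ambient marking of `𝒟^{⊚±}` is the identity. ([IUTchI] Def 6.1 (vi) p.159) [claim: Mochizuki2012, status: disputed] -/
theorem glbMark_gModelObj (h : Nonempty (D.gModelObj ≅ D.gModelObj)) : D.glbMark D.gModelObj h = Iso.refl _ := by
  rw [glbMark, dif_pos rfl, eqToIso_refl]

/-! ### The local datum of a place -/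

variable [Fact l.Prime]

/-- **The Π-avatar datum of ONE place `v̲`** ([IUTchI] Def 3.1 (e)(f), Def 6.1 (ii)(iii)): the local group `H = Π_v̲`, its
type-`(1,l-tors)` overgroup `Hund = Π^±_v̲ ≤ Π_{X̲_K}` (`†𝒟_v̲ → †𝒟_v̲^±`, Def 6.1 (ii) with the underline), the local arrow law of `H`,
the normaliser step `N(H) ≤ N(Hund)` (Cor 1.2 / [EtTh] Prop 2.4 in embedded form) and a NEGATIVE element (the `±`-involution: an
element of `Π_{C̲_K} ∖ Π_{X̲_K}` normalising `H`). Supplied at good places by `PiAvatarLocalOvergroupUnd` + abc-iut-L5-t4's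
`exists_localInvolution` (hA), at bad places by the SHAPE-OF-RECORD pair (G-L5t4g3-2 (iii)). ([IUTchI] Def 6.1 (ii) p.156) [claim: Mochizuki2012, status: disputed] -/
structure LocalDatum : Type w where
  /-- `Π_v̲` (good: `Π_{X̲→_K} ∩ augGF⁻¹ G_v̲`; bad: the profinite avatar of `Π^tp_{X̲̳_v̲}`) -/
  H : Subgroup D.PiC
  /-- `Π^±_v̲ = Π_{X̲_K} ∩ augGF⁻¹ G_v̲` — the group "corresponding to `X̲_v̲`" of Def 6.1 (ii) -/
  Hund : Subgroup D.PiC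
  /-- the local arrow law of `Π_v̲` (interface binder, p440701) -/
  law : D.LocalArrowLaw CG hS H
  /-- `Π_v̲ ≤ Π^±_v̲` -/
  le_und : H ≤ Hund
  /-- `Π^±_v̲ ≤ Π_{X̲_K}` -/
  und_le : Hund ≤ D.PiXund
  /-- `N(Π_v̲) ≤ N(Π^±_v̲)`: every automorphism of `†𝒟_v̲` extends to `†𝒟_v̲^±` (Def 6.1 (ii) «in a functorial fashion») -/
  normalizer_le_und : Subgroup.normalizer ((H : Subgroup D.PiC) : Set D.PiC) ≤ Subgroup.normalizer ((Hund : Subgroup D.PiC) : Set D.PiC)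
  /-- a negative element: some `c ∈ Π_{C̲_K} ∖ Π_{X̲_K}` normalises `Π_v̲` (the `±`-involution of `𝒟_v̲`, Def 6.1 (iii)/(v)) -/
  exists_neg : ∃ c ∈ Subgroup.normalizer ((H : Subgroup D.PiC) : Set D.PiC), c ∈ D.PiCund ∧ c ∉ D.PiXund

namespace LocalDatum

variable {D CG hS} (δ : D.LocalDatum CG hS)

/-- `N(Π^±_v̲) ≤ N(Π_{X̲_K})` (from the local arrow law: `d⁻¹ Π_v̲ d ≤ d⁻¹ Π^±_v̲ d = Π^±_v̲ ≤ Π_{X̲_K}`).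
([IUTchI] Def 6.1 (ii) p.156) [claim: Mochizuki2012, status: disputed] -/
theorem normalizer_und_le : Subgroup.normalizer ((δ.Hund : Subgroup D.PiC) : Set D.PiC) ≤
    Subgroup.normalizer ((D.PiXund : Subgroup D.PiC) : Set D.PiC) := by
  intro d hd
  refine δ.law.mem_normalizer_of_conj_le d fun x hx => δ.und_le ?_
  have h := (Subgroup.mem_normalizer_iff.mp (Subgroup.inv_mem _ hd) x).mp (δ.le_und hx)
  simpa using h

/-- `𝒟_v̲ = ℬ(Π_v̲)⁰` in the Π-ambient. ([IUTchI] Def 4.1 (i) p.95) [claim: Mochizuki2012, status: disputed] -/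
abbrev locObj : D.PiAmbient := OrbitCat.of δ.H

/-- `†𝒟_v̲^± = ℬ(Π^±_v̲)⁰` in the Π-ambient. ([IUTchI] Def 6.1 (ii) p.156) [claim: Mochizuki2012, status: disputed] -/
abbrev undObj : D.PiAmbient := OrbitCat.of δ.Hund

/-! ### The objects in play and the ambient `Amb v` -/

/-- **The objects in play at `v̲`**: isomorphs of `𝒟_v̲`, of `†𝒟_v̲^±`, or of `𝒟^{⊚±}` ([IUTchI] Def 4.1 (i) «a category equivalent to
`𝒟_v`»; Def 6.1 (ii) `†𝒟_v^±`; Def 6.1 (v)(vi) `†𝒟^{⊚±}`). ([IUTchI] Def 4.1 (i) p.95) [claim: Mochizuki2012, status: disputed] -/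
def InPlay : ObjectProperty D.PiAmbient := fun X =>
  Nonempty (X ≅ δ.locObj) ∨ Nonempty (X ≅ δ.undObj) ∨ Nonempty (X ≅ D.gModelObj)

/-- **Kit slot `Amb v`**: the full subcategory of the Π-ambient on the objects in play at `v̲` (one ambient for `†𝒟_v`, `†𝒟_v^±` and the
global objects seen at `v̲`, Def 6.1 (vii)). ([IUTchI] Def 6.1 (vii) p.159) [claim: Mochizuki2012, status: disputed] -/
abbrev Amb : Type w := (δ.InPlay).FullSubcategory

/-- **Kit slot `model v`**: `𝒟_v̲` as an object in play. ([IUTchI] Def 4.1 (i) p.95) [claim: Mochizuki2012, status: disputed] -/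
def model : δ.Amb := ⟨δ.locObj, Or.inl ⟨Iso.refl _⟩⟩

/-- `†𝒟_v̲^±` of the model, as an object in play. ([IUTchI] Def 6.1 (ii) p.156) [claim: Mochizuki2012, status: disputed] -/
def undModel : δ.Amb := ⟨δ.undObj, Or.inr (Or.inl ⟨Iso.refl _⟩)⟩

/-- The underlying ambient object of `model` is `ℬ(Π_v̲)⁰`. ([IUTchI] Def 4.1 (i) p.95) [claim: Mochizuki2012, status: disputed] -/
@[simp] theorem model_obj : δ.model.obj = δ.locObj := rfl

/-- The underlying ambient object of `undModel` is `ℬ(Π^±_v̲)⁰`. ([IUTchI] Def 6.1 (ii) p.156) [claim: Mochizuki2012, status: disputed] -/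
@[simp] theorem undModel_obj : δ.undModel.obj = δ.undObj := rfl

/-- Global isomorphs are in play. ([IUTchI] Def 6.1 (vii) p.159) [claim: Mochizuki2012, status: disputed] -/
theorem isGlobIsomorph_le_inPlay : D.IsGlobIsomorph ≤ δ.InPlay := fun _ hX => Or.inr (Or.inr hX)

/-- **Kit slot `atV v : Glob ⥤ Amb v`** — the global objects seen at `v̲` (the inclusion of full subcategories; Def 6.1 (vii): morphisms
`U → †𝒟^{⊚±}` are morphisms of the ambient). ([IUTchI] Def 6.1 (vii) p.159) [claim: Mochizuki2012, status: disputed] -/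
def atV : D.Glob ⥤ δ.Amb := ObjectProperty.ιOfLE δ.isGlobIsomorph_le_inPlay

/-- `atV` on objects keeps the underlying ambient object. ([IUTchI] Def 6.1 (vii) p.159) [claim: Mochizuki2012, status: disputed] -/
@[simp] theorem atV_obj_obj (G : D.Glob) : ((δ.atV).obj G).obj = G.obj := rfl

/-- `atV` on morphisms keeps the underlying ambient morphism. ([IUTchI] Def 6.1 (vii) p.159) [claim: Mochizuki2012, status: disputed] -/
@[simp] theorem atV_map_hom {G G' : D.Glob} (f : G ⟶ G') : ((δ.atV).map f).hom = f.hom := rfl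

/-- **Kit slot `phiEll v`: `φ^{Θell}_{•,v̲} : 𝒟_v̲ → 𝒟^{⊚±}`**, `xΠ_v̲ ↦ xΠ_{X̲_K}` (Ex 6.3 (i): «determined by the natural composite morphism
`X̲→_v → X_v → X_K`»). ([IUTchI] Ex 6.3 (i) p.161) [claim: Mochizuki2012, status: disputed] -/
def phiEll : δ.model ⟶ (δ.atV).obj D.gModel :=
  ObjectProperty.homMk (OrbitCat.homOfElem 1 (OrbitCat.one_conj_mem_of_le (δ.le_und.trans δ.und_le)))

/-- `φ^{Θell}_{•,v̲}` on cosets: `xΠ_v̲ ↦ xΠ_{X̲_K}`. ([IUTchI] Ex 6.3 (i) p.161) [claim: Mochizuki2012, status: disputed] -/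
theorem fn_phiEll_hom (x : D.PiC) :
    OrbitCat.fn (δ.phiEll).hom (QuotientGroup.mk x) = (QuotientGroup.mk (x * 1) : D.PiC ⧸ D.PiXund) := rfl

/-! ### Markings of the objects in play -/

open Classical in
/-- A chosen isomorphism `X ⥲ 𝒟_v̲` of an isomorph of `𝒟_v̲` (the identity at `𝒟_v̲` itself). ([IUTchI] Def 4.1 (i) p.95) [claim: Mochizuki2012, status: disputed] -/
def locMark (X : D.PiAmbient) (hX : Nonempty (X ≅ δ.locObj)) : X ≅ δ.locObj :=
  if h : X = δ.locObj then eqToIso h else hX.some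

open Classical in
/-- A chosen isomorphism `X ⥲ †𝒟_v̲^±` of an isomorph of `†𝒟_v̲^±` (the identity at `†𝒟_v̲^±`). ([IUTchI] Def 6.1 (ii) p.156) [claim: Mochizuki2012, status: disputed] -/
def undMark (X : D.PiAmbient) (hX : Nonempty (X ≅ δ.undObj)) : X ≅ δ.undObj :=
  if h : X = δ.undObj then eqToIso h else hX.some

/-- The marking of `𝒟_v̲` is the identity. ([IUTchI] Def 4.1 (i) p.95) [claim: Mochizuki2012, status: disputed] -/
theorem locMark_locObj (h : Nonempty (δ.locObj ≅ δ.locObj)) : δ.locMark δ.locObj h = Iso.refl _ := by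
  rw [locMark, dif_pos rfl, eqToIso_refl]

/-! ### Kit slot `labMap` on all ambient objects in play -/

open Classical in
/-- **Kit slot `labMap v`** on an isomorphism `φ : X ⥲ Y` of ambient objects: for isomorphs of `𝒟_v̲` the label action (`locLabAut`) of the
marking-reduced automorphism `μ_X⁻¹ φ μ_Y` of `𝒟_v̲` (Def 6.1 (iii) «the induced automorphism of `LabCusp^±(†𝒟_v)`»); on isomorphs of
`†𝒟_v̲^±` / `𝒟^{⊚±}` the analogous actions (`subLabAut Π^±_v̲`, `gLabAutModel`) — these only serve the naturality laws; identity otherwise.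
([IUTchI] Def 6.1 (iii) p.157) [claim: Mochizuki2012, status: disputed] -/
def labMapAmb {X Y : D.PiAmbient} (φ : X ≅ Y) : D.geom.pe.Cusp ≃ D.geom.pe.Cusp :=
  if hX : Nonempty (X ≅ δ.locObj) then
    δ.law.locLabAut ((δ.locMark X hX).symm ≪≫ φ ≪≫ δ.locMark Y ⟨φ.symm ≪≫ hX.some⟩)
  else if hX' : Nonempty (X ≅ δ.undObj) then
    D.subLabAut CG hS δ.normalizer_und_le δ.und_le ((δ.undMark X hX').symm ≪≫ φ ≪≫ δ.undMark Y ⟨φ.symm ≪≫ hX'.some⟩)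
  else if hX'' : Nonempty (X ≅ D.gModelObj) then
    D.gLabAutModel CG hS ((D.glbMark X hX'').symm ≪≫ φ ≪≫ D.glbMark Y ⟨φ.symm ≪≫ hX''.some⟩)
  else Equiv.refl _

/-- The local branch: for an isomorph `X` of `𝒟_v̲`, `labMapAmb φ = locLabAut (μ_X⁻¹ ≫ φ ≫ μ_Y)`.
([IUTchI] Def 6.1 (iii) p.157) [claim: Mochizuki2012, status: disputed] -/
theorem labMapAmb_of_loc {X Y : D.PiAmbient} (φ : X ≅ Y) (hX : Nonempty (X ≅ δ.locObj)) (hY : Nonempty (Y ≅ δ.locObj)) :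
    δ.labMapAmb φ = δ.law.locLabAut ((δ.locMark X hX).symm ≪≫ φ ≪≫ δ.locMark Y hY) := by
  rw [labMapAmb, dif_pos hX]

/-- The `†𝒟^±`-branch. ([IUTchI] Def 6.1 (ii) p.156) [claim: Mochizuki2012, status: disputed] -/
theorem labMapAmb_of_und {X Y : D.PiAmbient} (φ : X ≅ Y) (hX : ¬ Nonempty (X ≅ δ.locObj)) (hX' : Nonempty (X ≅ δ.undObj))
    (hY' : Nonempty (Y ≅ δ.undObj)) :
    δ.labMapAmb φ = D.subLabAut CG hS δ.normalizer_und_le δ.und_le ((δ.undMark X hX').symm ≪≫ φ ≪≫ δ.undMark Y hY') := by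
  rw [labMapAmb, dif_neg hX, dif_pos hX']

/-- The global branch. ([IUTchI] Def 6.1 (vi) p.159) [claim: Mochizuki2012, status: disputed] -/
theorem labMapAmb_of_glb {X Y : D.PiAmbient} (φ : X ≅ Y) (hX : ¬ Nonempty (X ≅ δ.locObj)) (hX' : ¬ Nonempty (X ≅ δ.undObj))
    (hX'' : Nonempty (X ≅ D.gModelObj)) (hY'' : Nonempty (Y ≅ D.gModelObj)) :
    δ.labMapAmb φ = D.gLabAutModel CG hS ((D.glbMark X hX'').symm ≪≫ φ ≪≫ D.glbMark Y hY'') := by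
  rw [labMapAmb, dif_neg hX, dif_neg hX', dif_pos hX'']

/-- The junk branch (objects not in play). ([IUTchI] Def 6.1 (vii) p.159) [claim: Mochizuki2012, status: disputed] -/
theorem labMapAmb_of_not {X Y : D.PiAmbient} (φ : X ≅ Y) (hX : ¬ Nonempty (X ≅ δ.locObj)) (hX' : ¬ Nonempty (X ≅ δ.undObj))
    (hX'' : ¬ Nonempty (X ≅ D.gModelObj)) : δ.labMapAmb φ = Equiv.refl _ := by
  rw [labMapAmb, dif_neg hX, dif_neg hX', dif_neg hX'']

/-- At the model `𝒟_v̲` itself: `labMapAmb α = locLabAut α`. ([IUTchI] Def 6.1 (iii) p.157) [claim: Mochizuki2012, status: disputed] -/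
theorem labMapAmb_locObj (α : δ.locObj ≅ δ.locObj) : δ.labMapAmb α = δ.law.locLabAut α := by
  rw [δ.labMapAmb_of_loc α ⟨Iso.refl _⟩ ⟨Iso.refl _⟩, locMark_locObj, Iso.refl_symm, Iso.refl_trans, Iso.trans_refl]

/-- **Kit law `labMap_refl`.** ([IUTchI] Def 6.1 (iii) p.157) [claim: Mochizuki2012, status: disputed] -/
theorem labMapAmb_refl (X : D.PiAmbient) : δ.labMapAmb (Iso.refl X) = Equiv.refl _ := by
  by_cases hX : Nonempty (X ≅ δ.locObj)
  · rw [δ.labMapAmb_of_loc _ hX hX, Iso.refl_trans, Iso.symm_self_id]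
    exact map_one δ.law.locLabAut
  by_cases hX' : Nonempty (X ≅ δ.undObj)
  · rw [δ.labMapAmb_of_und _ hX hX' hX', Iso.refl_trans, Iso.symm_self_id]
    exact map_one (D.subLabAut CG hS δ.normalizer_und_le δ.und_le)
  by_cases hX'' : Nonempty (X ≅ D.gModelObj)
  · rw [δ.labMapAmb_of_glb _ hX hX' hX'' hX'', Iso.refl_trans, Iso.symm_self_id]
    exact map_one (D.gLabAutModel CG hS)
  · exact δ.labMapAmb_of_not _ hX hX' hX''

/-- Reduction of a composite splits at the middle marking (an identity of isomorphisms). [folklore] -/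
private theorem reduce_trans {C : Type*} [Category C] {X Y Z M : C} (μX : X ≅ M) (μY : Y ≅ M) (μZ : Z ≅ M) (φ : X ≅ Y) (ψ : Y ≅ Z) :
    μX.symm ≪≫ (φ ≪≫ ψ) ≪≫ μZ = (μX.symm ≪≫ φ ≪≫ μY) ≪≫ (μY.symm ≪≫ ψ ≪≫ μZ) := by
  simp only [Iso.trans_assoc, Iso.self_symm_id_assoc]

/-- **Kit law `labMap_trans`.** ([IUTchI] Def 6.1 (iii) p.157) [claim: Mochizuki2012, status: disputed] -/
theorem labMapAmb_trans {X Y Z : D.PiAmbient} (φ : X ≅ Y) (ψ : Y ≅ Z) :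
    δ.labMapAmb (φ ≪≫ ψ) = (δ.labMapAmb φ).trans (δ.labMapAmb ψ) := by
  by_cases hX : Nonempty (X ≅ δ.locObj)
  · have hY : Nonempty (Y ≅ δ.locObj) := ⟨φ.symm ≪≫ hX.some⟩
    have hZ : Nonempty (Z ≅ δ.locObj) := ⟨ψ.symm ≪≫ hY.some⟩
    rw [δ.labMapAmb_of_loc _ hX hZ, δ.labMapAmb_of_loc _ hX hY, δ.labMapAmb_of_loc _ hY hZ,
      reduce_trans (δ.locMark X hX) (δ.locMark Y hY) (δ.locMark Z hZ) φ ψ, ← Aut.Aut_mul_def, map_mul, Equiv.Perm.mul_def]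
  by_cases hX' : Nonempty (X ≅ δ.undObj)
  · have hY : ¬ Nonempty (Y ≅ δ.locObj) := fun h => hX ⟨φ ≪≫ h.some⟩
    have hY' : Nonempty (Y ≅ δ.undObj) := ⟨φ.symm ≪≫ hX'.some⟩
    have hZ' : Nonempty (Z ≅ δ.undObj) := ⟨ψ.symm ≪≫ hY'.some⟩
    rw [δ.labMapAmb_of_und _ hX hX' hZ', δ.labMapAmb_of_und _ hX hX' hY', δ.labMapAmb_of_und _ hY hY' hZ',
      reduce_trans (δ.undMark X hX') (δ.undMark Y hY') (δ.undMark Z hZ') φ ψ, ← Aut.Aut_mul_def, map_mul, Equiv.Perm.mul_def]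
  by_cases hX'' : Nonempty (X ≅ D.gModelObj)
  · have hY : ¬ Nonempty (Y ≅ δ.locObj) := fun h => hX ⟨φ ≪≫ h.some⟩
    have hY' : ¬ Nonempty (Y ≅ δ.undObj) := fun h => hX' ⟨φ ≪≫ h.some⟩
    have hY'' : Nonempty (Y ≅ D.gModelObj) := ⟨φ.symm ≪≫ hX''.some⟩
    have hZ'' : Nonempty (Z ≅ D.gModelObj) := ⟨ψ.symm ≪≫ hY''.some⟩
    rw [δ.labMapAmb_of_glb _ hX hX' hX'' hZ'', δ.labMapAmb_of_glb _ hX hX' hX'' hY'', δ.labMapAmb_of_glb _ hY hY' hY'' hZ'',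
      reduce_trans (D.glbMark X hX'') (D.glbMark Y hY'') (D.glbMark Z hZ'') φ ψ, ← Aut.Aut_mul_def, map_mul, Equiv.Perm.mul_def]
  · have hY : ¬ Nonempty (Y ≅ δ.locObj) := fun h => hX ⟨φ ≪≫ h.some⟩
    have hY' : ¬ Nonempty (Y ≅ δ.undObj) := fun h => hX' ⟨φ ≪≫ h.some⟩
    have hY'' : ¬ Nonempty (Y ≅ D.gModelObj) := fun h => hX'' ⟨φ ≪≫ h.some⟩
    rw [δ.labMapAmb_of_not _ hX hX' hX'', δ.labMapAmb_of_not _ hX hX' hX'', δ.labMapAmb_of_not _ hY hY' hY'']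
    rfl

/-- **Kit law `labMap_charts`** (isomorphs of `𝒟_v̲`; charts are `{±gChart₀}` on every isomorph): pulling back a chart along the label
bijection of an isomorphism gives a chart. ([IUTchI] Def 6.1 (iii) p.157) [claim: Mochizuki2012, status: disputed] -/
theorem labMapAmb_trans_mem_charts {X Y : D.PiAmbient} (hX : Nonempty (X ≅ δ.locObj)) (φ : X ≅ Y)
    {e : D.geom.pe.Cusp ≃ ZMod l} (he : e ∈ (D.gLabPMModel CG).charts) :
    (δ.labMapAmb φ).trans e ∈ (D.gLabPMModel CG).charts := by
  rw [δ.labMapAmb_of_loc φ hX ⟨φ.symm ≪≫ hX.some⟩]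
  exact δ.law.locLabAut_trans_mem_charts _ he

/-- **Kit law `exists_negative`** on every isomorph of `𝒟_v̲`: the negative element of the datum, conjugated by the marking, acts
non-trivially. ([IUTchI] Def 6.1 (iii) p.157) [claim: Mochizuki2012, status: disputed] -/
theorem exists_labMapAmb_ne_refl {X : D.PiAmbient} (hX : Nonempty (X ≅ δ.locObj)) :
    ∃ α : X ≅ X, δ.labMapAmb α ≠ Equiv.refl _ := by
  obtain ⟨α₀, hα₀⟩ := δ.law.exists_locLabAut_ne_one δ.exists_neg
  refine ⟨δ.locMark X hX ≪≫ α₀ ≪≫ (δ.locMark X hX).symm, ?_⟩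
  rw [δ.labMapAmb_of_loc _ hX hX]
  have h : (δ.locMark X hX).symm ≪≫ (δ.locMark X hX ≪≫ α₀ ≪≫ (δ.locMark X hX).symm) ≪≫ δ.locMark X hX = α₀ := by
    simp only [Iso.trans_assoc, Iso.symm_self_id_assoc, Iso.symm_self_id, Iso.trans_refl]
  rw [h]
  exact hα₀

end LocalDatum

end InitialThetaData

end LocalAmbient

end Literature.IUT.HodgeTheaters
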